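import Summits.HodgeConjecture.HodgeConjecture.Theorems.LimitExtensionSpecialisationOfAlgebraicityOfSpread
import Summits.HodgeConjecture.HodgeConjecture.Theorems.LimitExtensionSpecialisationOfAlgebraicityLocalLimit

/-!
# Route LimitExtension — `SpecialisationOfAlgebraicity` (item stmt-HodgeConjecture-2998) from LOCAL spread data

The support item `SpecialisationOfAlgebraicity` was proved in `…OfSpread` modulo SPREAD — one
Zariski-closed `𝒵 ⊆ W` off whose slices the algebraic classes `B_t` die for ALL `t ≠ t₀`, with
slice over `t₀` of codimension `≥ k`. This file weakens that remaining hypothesis to what the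
classical Hilbert-scheme / multisection argument actually delivers (Voisin, *Hodge Theory II*,
§3.3.1 and proof of Thm. 10.19; Charles–Schnell, proof of Prop. 11.3.11; Fulton 1998 §10.1), the
shape of the tree's named fact `HodgeTheory.spread_supports_over_projectiveLine`:

* dying-off is only asked OFF A PROPER ZARISKI-CLOSED `S' ⊊ T` (finitely many exceptional
  parameters near `t₀` are allowed; `…LocalLimit`), and
* the support bound is only asked on the slice over `t₀`, as the pointwise dimension bound
  `dim {m}⁻ + k ≤ 2k` (`Order.height m + k ≤ 2k`), meaningful on the singular special fibre.

Proved here (sorry-free): `map_comp_fiberι_mem_supportedClasses_one_of_localSpread` — the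
conclusion of the item for ONE family from local spread data `(𝒵, S')` — and
`specialisationOfAlgebraicity_of_localSpread` — **item ⇐ local SPREAD**.
-/

noncomputable section

-- `Summit.HodgeConjecture.HodgeConjecture.Theorems` is the mandated namespace (single-conjunct summit:
-- Sub = Summit), which `linter.dupNamespace` flags on every declaration; the lakefile turns the
-- linter off tree-wide (weak option), restated here so stand-alone elaboration is warning-free too.
set_option linter.dupNamespace false

open scoped Topology
open Set Function Filter

namespace Summit.HodgeConjecture.HodgeConjecture.Theorems

/-! ### The item from local spread data -/

section LocalSpread

open CategoryTheory CategoryTheory.Limits AlgebraicGeometry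
open Literature.AlgebraicGeometry.Motives Literature.AlgebraicGeometry.HodgeTheory

/-- **The conclusion of the item from LOCAL spread data.** Let `X` be smooth projective of
dimension `2k` (`k ≥ 1`), `T` a smooth irreducible curve, `f : W ⟶ T` flat and proper,
`g : X ⟶ W_{t₀}` an open immersion on a non-empty open `U ⊆ X`, and `B ∈ H^{2k}(W(ℂ); ℂ)`. Suppose
given a Zariski-closed `𝒵 ⊆ W` whose slice over `t₀` has dimension `≤ k` pointwise
(`height m + k ≤ 2k`) and a proper Zariski-closed `S' ⊊ T` such that `B|_{W_t}` dies off the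
slice `𝒵_t` for every complex `t` off `S'`. Then `(g ≫ ι_{t₀})^* B ∈ N¹ H^{2k}(X(ℂ); ℂ)`. Proof:
`t₀` is isolated in `S'` (`exists_opens_forall_mem_eq_of_smoothCurve`), so the local `limit`
theorem `restrictCompl_map_eq_zero_of_forall_ne_of_mem` kills `(g ≫ ι)^* B` on `U₂(ℂ) ∖ 𝒵(ℂ)` for
the open piece `U₂ ⊆ U` inside one smooth chart of `f` (fibre criterion); the generic point of `U₂`
has `height = 2k > k`, so it is not in `𝒵`, and the coniveau bookkeeping
`mem_supportedClasses_one_of_restrictCompl_map_eq_zero` concludes. No hypothesis on the other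
fibres is needed at this stage. [cite: Fulton1998, §10.1 and §20.3]
[cite: VoisinHodgeII2003, §3.3.1] -/
theorem map_comp_fiberι_mem_supportedClasses_one_of_localSpread {k : ℕ} {X T W : SchemeOver ℂ}
    (f : W ⟶ T) (t₀ : ComplexPoints T) (g : X ⟶ fiberOver f t₀) (B : complexBetti W (2 * k))
    (hk : 0 < k) (hX : IsSmoothProjective (2 * k) X) (hT : SmoothOfRelativeDimension 1 T.hom)
    [IrreducibleSpace T.left] (hflat : Flat f.left) (hprop : IsProper f.left)
    (hU : ∃ U : X.left.Opens, (U : Set X.left).Nonempty ∧ IsOpenImmersion (U.ι ≫ g.left))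
    {𝒵 : Set W.left} (h𝒵 : IsClosed 𝒵)
    (hdim : ∀ m : ↥(fiberOver f t₀).left, (fiberι f t₀).left.base m ∈ 𝒵 →
      Order.height m + k ≤ (2 * k : ℕ))
    {S' : Set T.left} (hS' : IsClosed S') (hS'ne : S' ≠ Set.univ)
    (hdies : ∀ t : ComplexPoints T, t.pt ∉ S' →
      complexBetti.restrictCompl (fiberOver f t) ((fiberι f t).left.base ⁻¹' 𝒵) (2 * k)
        (complexBetti.map (fiberι f t) (2 * k) B) = 0) :
    complexBetti.map (g ≫ fiberι f t₀) (2 * k) B ∈ supportedClasses X (2 * k) 1 := by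
  obtain ⟨U, hUne, hUg⟩ := hU
  haveI : IrreducibleSpace X.left := hX.irreducibleSpace
  haveI := hT
  haveI := hflat
  haveI := hprop
  haveI : Smooth T.hom := SmoothOfRelativeDimension.smooth 1 T.hom
  haveI : LocallyOfFiniteType T.hom := inferInstance
  haveI : IsLocallyNoetherian T.left := LocallyOfFiniteType.isLocallyNoetherian T.hom
  haveI : LocallyOfFinitePresentation f.left :=
    Literature.AlgebraicGeometry.HodgeTheory.locallyOfFinitePresentation_of_isLocallyNoetherian f.left
  -- `t₀` is isolated in `S'`: the dying-off hypothesis in the local form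
  obtain ⟨T₂, ht₀T₂, hT₂⟩ := exists_opens_forall_mem_eq_of_smoothCurve hT hS' hS'ne t₀.pt
  have hdies' : ∀ t : ComplexPoints T, t ≠ t₀ → t.pt ∈ T₂ →
      complexBetti.restrictCompl (fiberOver f t) ((fiberι f t).left.base ⁻¹' 𝒵) (2 * k)
        (complexBetti.map (fiberι f t) (2 * k) B) = 0 := fun t ht htT₂ =>
    hdies t fun htS' => ht (ComplexPoints.ext_of_pt_eq (hT₂ t.pt htT₂ htS'))
  -- a point `v₀ ∈ U`, its image `x₀ ∈ W` lies in `sm(f)` (fibre criterion) and in a chart `U'`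
  obtain ⟨v₀, hv₀⟩ := hUne
  let V₁ : SchemeOver ℂ := Over.mk (U.ι ≫ X.hom)
  let j₁ : V₁ ⟶ fiberOver f t₀ := Over.homMk U.ι rfl ≫ g
  haveI : IsOpenImmersion j₁.left := hUg
  haveI := hX.smoothOfRelativeDimension
  haveI : Smooth X.hom := SmoothOfRelativeDimension.smooth (2 * k) X.hom
  haveI : Smooth V₁.hom := by
    change Smooth (U.ι ≫ X.hom)
    infer_instance
  have hx₀ : (j₁ ≫ fiberι f t₀).left.base ⟨v₀, hv₀⟩ ∈ f.left.smoothLocus :=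
    mem_smoothLocus_of_isOpenImmersion_fiberOver f t₀ j₁ ⟨v₀, hv₀⟩
  obtain ⟨U', N, hx₀U', hsmN⟩ := exists_smoothOfRelativeDimension_of_mem_smoothLocus f.left hx₀
  -- shrink the open piece: `U₂ = U ∩ (g ≫ ι)⁻¹ U'`
  set U₂ : X.left.Opens := U ⊓ (g ≫ fiberι f t₀).left ⁻¹ᵁ U' with hU₂
  have hv₀U₂ : v₀ ∈ U₂ := ⟨hv₀, hx₀U'⟩
  let V : SchemeOver ℂ := Over.mk (U₂.ι ≫ X.hom)
  let jU : V ⟶ X := Over.homMk U₂.ι rfl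
  let j : V ⟶ fiberOver f t₀ := jU ≫ g
  haveI hjU : IsOpenImmersion jU.left := inferInstanceAs (IsOpenImmersion U₂.ι)
  haveI : Nonempty V.left := ⟨(⟨v₀, hv₀U₂⟩ : U₂)⟩
  have hVirr : IrreducibleSpace V.left := by
    haveI : Nonempty U₂ := ⟨⟨v₀, hv₀U₂⟩⟩
    exact isIrreducible_iff_irreducibleSpace.mp
      ⟨⟨v₀, hv₀U₂⟩, (PreirreducibleSpace.isPreirreducible_univ (X := X.left)).open_subset U₂.isOpen
        (Set.subset_univ _)⟩
  have hVsm : SmoothOfRelativeDimension (2 * k) V.hom := by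
    have h : SmoothOfRelativeDimension (0 + 2 * k) (U₂.ι ≫ X.hom) := inferInstance
    rwa [Nat.zero_add] at h
  haveI : IsOpenImmersion j.left := by
    change IsOpenImmersion (U₂.ι ≫ g.left)
    rw [← Scheme.homOfLE_ι X.left (inf_le_left : U₂ ≤ U), Category.assoc]
    haveI : IsOpenImmersion (U.ι ≫ g.left) := hUg
    infer_instance
  have hrange : Set.range (j ≫ fiberι f t₀).left.base ⊆ (U' : Set W.left) := by
    rintro _ ⟨v, rfl⟩
    exact v.2.2
  -- the local `limit` theorem on the shrunk piece
  have h0 := restrictCompl_map_eq_zero_of_forall_ne_of_mem f t₀ j 𝒵 B hT hprop h𝒵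
    ⟨U', hrange, hsmN⟩ T₂ ht₀T₂ hdies'
  -- `Z₀ = (j ≫ ι)⁻¹ 𝒵` is a proper closed subset of `V`: the generic point has `height = 2k > k`
  have hZ₀ : IsClosed ((j ≫ fiberι f t₀).left.base ⁻¹' 𝒵) :=
    h𝒵.preimage (j ≫ fiberι f t₀).left.base.hom.continuous
  have hZ₀ne : (j ≫ fiberι f t₀).left.base ⁻¹' 𝒵 ≠ Set.univ := by
    intro huniv
    have hη : genericPoint V.left ∈ (j ≫ fiberι f t₀).left.base ⁻¹' 𝒵 := huniv ▸ Set.mem_univ _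
    have hη' : (fiberι f t₀).left.base (j.left.base (genericPoint V.left)) ∈ 𝒵 := hη
    have h1 := hdim (j.left.base (genericPoint V.left)) hη'
    -- `height (generic point of V) = 2k`
    have hgen : Order.height (genericPoint V.left) = (2 * k : ℕ) := by
      haveI := hVsm
      have h := Literature.AlgebraicGeometry.Motives.height_add_coheight_eq_of_smoothOfRelativeDimension
        V.hom (2 * k) (genericPoint V.left)
      rwa [coheight_eq_zero_of_isGenericPoint_univ (genericPoint_spec V.left), add_zero] at h
    -- heights do not decrease under the open immersion `j`
    have hmono : Order.height (genericPoint V.left) ≤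
        Order.height (j.left.base (genericPoint V.left)) :=
      Order.height_le_height_apply_of_strictMono _
        (Literature.AlgebraicGeometry.Motives.strictMono_base_of_isOpenImmersion j.left) _
    rw [hgen] at hmono
    have h2 : ((2 * k : ℕ) : ℕ∞) + k ≤ (2 * k : ℕ) := (add_le_add hmono le_rfl).trans h1
    have h3 : ((2 * k + k : ℕ) : ℕ∞) ≤ ((2 * k : ℕ) : ℕ∞) := by rwa [Nat.cast_add]
    have h4 : 2 * k + k ≤ 2 * k := by exact_mod_cast h3
    omega
  have hcomp : complexBetti.map (j ≫ fiberι f t₀) (2 * k) B =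
      complexBetti.map jU (2 * k) (complexBetti.map (g ≫ fiberι f t₀) (2 * k) B) := by
    rw [show j ≫ fiberι f t₀ = jU ≫ (g ≫ fiberι f t₀) from Category.assoc _ _ _,
      complexBetti.map_comp, ModuleCat.comp_apply]
  rw [hcomp] at h0
  have hpre : (j ≫ fiberι f t₀).left.base ⁻¹' 𝒵 =
      jU.left.base ⁻¹' ((g ≫ fiberι f t₀).left.base ⁻¹' 𝒵) := by
    rw [← Set.preimage_comp]
    rfl
  rw [hpre] at h0 hZ₀ hZ₀ne
  exact mem_supportedClasses_one_of_restrictCompl_map_eq_zero hX jU hZ₀ hZ₀ne h0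

/-- **Item stmt-HodgeConjecture-2998 ⇐ local SPREAD.** The support item
`SpecialisationOfAlgebraicity` of route `LimitExtension` follows from the LOCAL form of the
spreading of algebraic supports along the family — exactly what the classical argument (countably
many proper parameter spaces of supports / relative Hilbert schemes over the good locus, a
dominating good component, a multisection curve, closure in `W`: Voisin II §3.3.1 and proof of
Thm. 10.19; Charles–Schnell, proof of Prop. 11.3.11; Fulton 1998 §10.1) produces: a Zariski-closed
`𝒵 ⊆ W` with slice over `t₀` of dimension `≤ k` pointwise and a proper Zariski-closed `S' ⊊ T` off
which the algebraic classes `B_t` die off the slices `𝒵_t`. Compared with the hypothesis `spread`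
of `specialisationOfAlgebraicity_of_spread`, finitely many exceptional `t ≠ t₀` near `t₀` are now
allowed and no equidimensionality of the special fibre is presupposed.
[cite: VoisinHodgeII2003, §3.3.1 and §10.2.1 (proof of Thm. 10.19)]
[cite: Fulton1998, §10.1 and §20.3] -/
theorem specialisationOfAlgebraicity_of_localSpread
    (localSpread : ∀ ⦃k : ℕ⦄ ⦃T W : SchemeOver ℂ⦄ (f : W ⟶ T) (t₀ : ComplexPoints T)
      (B : complexBetti W (2 * k)), 0 < k →
      SmoothOfRelativeDimension 1 T.hom → IrreducibleSpace T.left → Flat f.left →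
      IsProper f.left →
      (∀ t : ComplexPoints T, t ≠ t₀ → IsSmoothProjective (2 * k) (fiberOver f t) ∧
        complexBetti.map (fiberι f t) (2 * k) B ∈ algebraicClasses (fiberOver f t) k) →
      ∃ 𝒵 : Set W.left, IsClosed 𝒵 ∧
        (∀ m : ↥(fiberOver f t₀).left, (fiberι f t₀).left.base m ∈ 𝒵 →
          Order.height m + k ≤ (2 * k : ℕ)) ∧
        ∃ S' : Set T.left, IsClosed S' ∧ S' ≠ Set.univ ∧
          ∀ t : ComplexPoints T, t.pt ∉ S' →
            complexBetti.restrictCompl (fiberOver f t) ((fiberι f t).left.base ⁻¹' 𝒵) (2 * k)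
              (complexBetti.map (fiberι f t) (2 * k) B) = 0) :
    Summit.HodgeConjecture.HodgeConjecture.Theses.LimitExtension.SpecialisationOfAlgebraicity := by
  unfold Summit.HodgeConjecture.HodgeConjecture.Theses.LimitExtension.SpecialisationOfAlgebraicity
  intro k X T W f t₀ g B hk hX hT hTirr hflat hprop hU hfib
  obtain ⟨𝒵, h𝒵, hdim, S', hS', hS'ne, hdies⟩ := localSpread f t₀ B hk hT hTirr hflat hprop hfib
  exact map_comp_fiberι_mem_supportedClasses_one_of_localSpread f t₀ g B hk hX hT hflat hprop hU
    h𝒵 hdim hS' hS'ne hdies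

end LocalSpread

end Summit.HodgeConjecture.HodgeConjecture.Theorems

end
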